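import Mathlib
import HarnessLib
import Summits.Langlands.Langlands.Statement
import Summits.Langlands.Langlands.Theorems.SkinnerWilesDefectOneEisensteinProModularSeedQuadraticBaseChangeTwist

/-!
# Stub `stub_twistAutomorphicTransport` (S7d) of the line `descend-raise-basechange`
# (crux `Summit.Langlands.Langlands.Theses.SkinnerWilesDefectOne.EisensteinProModularSeed`, stmt-Langlands-12920)

**S7d — transport of the automorphic side along a finite-order scalar twist** (the TWISTED-COUSIN
regime of skeleton v5).  `F` a number field, `p` a prime, `ι : ℚ̄_p ≃ ℂ`; `πF` a cuspidal automorphic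
representation of `GL₂(𝔸_F)` with a regular L-algebraic infinity type `T`; `r', r : Γ_F → GL₂(ℚ̄_p)`
continuous and `ν : Γ_F → ℚ̄_pˣ` continuous of finite order with `r(σ) = ν(σ) • r'(σ)` entrywise;
`S ⊆ S'` sets of finite places with `πF` Satake–Frobenius compatible with `r'` off `S`, and `r` and
`ν` unramified off `S'`.  THEN there is a cuspidal `πF'` on `GL₂(𝔸_F)` with a regular L-algebraic
infinity type that is Satake–Frobenius compatible with `r` off `S'`.

Proof (pure bookkeeping over proved tree lemmas, exactly steps (3)–(4) of the landed S4):
let `χ` be the finite-order Hecke character of `ν` (`exists_heckeCharacter_of_finiteOrder`, global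
class field theory in the tree: `χ` is unramified wherever `ν` kills inertia, and
`ν(Frob_v) = ι⁻¹(χ(ϖ_v))⁻¹` there); put `πF' := πF ⊗ (χ ∘ det)` (`CuspidalAutomorphicRepData.twist`,
cuspidal) and `T' := T`: the archimedean parameter is unchanged (`HasArchParameter.twist`), and at
`v ∉ S'` (so `v ∉ S`) the twist formula `satakeFrobCompatibleAt_twist` turns
`SatakeFrobCompatibleAt ι πF r' v` into `SatakeFrobCompatibleAt ι (πF ⊗ χ) r v`.

References: J. Arthur, L. Clozel, *Simple algebras, base change, and the advanced theory of the trace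
formula*, Ann. of Math. Stud. 120 (1989), Ch. 3 Thm. 3.1; J. W. S. Cassels, A. Fröhlich (eds.),
*Algebraic Number Theory* (1967), Ch. VII §5.1. [folklore]
-/

set_option linter.dupNamespace false -- project-wide option (lakefile weak.linter.dupNamespace); `Summit.Langlands.Langlands` is the mandated namespace

noncomputable section

open scoped MatrixGroups Matrix NumberField Classical
open NumberField IsDedekindDomain Field Filter
open Literature.NumberTheory.Automorphic Literature.NumberTheory.GaloisRepresentations

namespace Summit.Langlands.Langlands.Theorems.SkinnerWilesDefectOne.EisensteinProModularSeed

/-- **stub_twistAutomorphicTransport** (line `descend-raise-basechange`, S7d — transport of the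
automorphic side along the finite-order scalar twist `ν`): for `πF` cuspidal on `GL₂(𝔸_F)` with a
regular L-algebraic infinity type `T`, `r = ν • r'` with `ν` of finite order, `S ⊆ S'`, `πF`
Satake–Frobenius compatible with `r'` off `S`, and `r`, `ν` unramified off `S'`, the twist
`πF' := πF ⊗ (χ_ν ∘ det)` (with `T' := T`) is cuspidal with the same infinity type and
Satake–Frobenius compatible with `r` off `S'`.  Statement = the registered stub of the line skeleton
v5, verbatim. Arthur–Clozel (1989) Ch. 3 Thm. 3.1; Cassels–Fröhlich (1967) Ch. VII §5.1. [folklore] -/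
theorem stub_twistAutomorphicTransport :
    ∀ (F : Type) [Field F] [NumberField F] (p : ℕ) [Fact p.Prime]
      (hcpt : Literature.NumberTheory.Automorphic.isCompact_glFiniteIntegralLevel 2 F) (ι : PadicAlgCl p ≃+* ℂ)
      (πF : Literature.NumberTheory.Automorphic.CuspidalAutomorphicRepData 2 F hcpt) (T : Literature.NumberTheory.Automorphic.InfinityType F 2),
      πF.1.HasInfinityType T → T.IsLAlgebraic → T.IsRegular →
      ∀ (r' r : Literature.NumberTheory.GaloisRepresentations.FramedGaloisRep F (PadicAlgCl p) 2)
        (ν : Field.absoluteGaloisGroup F →ₜ* (PadicAlgCl p)ˣ),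
      (∃ n : ℕ, 0 < n ∧ ∀ σ, ν σ ^ n = 1) →
      (∀ σ, (r σ).val = ((ν σ : (PadicAlgCl p)ˣ) : PadicAlgCl p) • (r' σ).val) →
      ∀ (S S' : Set (IsDedekindDomain.HeightOneSpectrum (NumberField.RingOfIntegers F))), S ⊆ S' →
      (∀ v ∉ S, Summit.Langlands.SatakeFrobCompatibleAt ι πF.1 r' v) →
      (∀ v ∉ S', r.IsUnramifiedAt v) →
      (∀ v ∉ S', ∀ 𝔓 ∈ v.primesAbove, ∀ σ ∈ 𝔓.inertia (Field.absoluteGaloisGroup F), ν σ = 1) →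
      ∃ (πF' : Literature.NumberTheory.Automorphic.CuspidalAutomorphicRepData 2 F hcpt) (T' : Literature.NumberTheory.Automorphic.InfinityType F 2),
        πF'.1.HasInfinityType T' ∧ T'.IsLAlgebraic ∧ T'.IsRegular ∧
        ∀ v ∉ S', Summit.Langlands.SatakeFrobCompatibleAt ι πF'.1 r v := by
  intro F _ _ p _ hcpt ι πF T hT hTL hTR r' r ν hν hrel S S' hSS' hcompat hrunr hνS'
  -- (1) the Hecke character `χ` of `ν` and the twist `πF' = πF ⊗ (χ ∘ det)`, `T' = T`
  obtain ⟨χ, hχ, hχν⟩ := exists_heckeCharacter_of_finiteOrder ι ν hν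
  refine ⟨πF.twist χ hχ, T, ⟨hT.1, ?_⟩, hTL, hTR, fun v hv => ?_⟩
  · rw [CuspidalAutomorphicRepData.twist_val]
    exact AutomorphicRepData.HasArchParameter.twist πF.1 χ hχ hT.2
  -- (2) compatibility at `v ∉ S'`
  obtain ⟨hχv, hνv⟩ := hχν v (hνS' v hv)
  have hc : Summit.Langlands.SatakeFrobCompatibleAt ι πF.1 r' v := hcompat v (fun h => hv (hSS' h))
  rw [CuspidalAutomorphicRepData.twist_val]
  exact satakeFrobCompatibleAt_twist ι πF.1 r' r hχ
    (fun σ => ((ν σ : (PadicAlgCl p)ˣ) : PadicAlgCl p)) hrel hχv hνv (hrunr v hv) hc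

end Summit.Langlands.Langlands.Theorems.SkinnerWilesDefectOne.EisensteinProModularSeed

end
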